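import Literature.NumberTheory.Transcendental.KaehlerHodge
import Literature.NumberTheory.Transcendental.DolbeaultProofs
import Literature.NumberTheory.Transcendental.ComplexFormsHighType
import Literature.Geometry.Kaehler.RiemannianHodgeRoughMetric
import HarnessLib

/-!
# A rough metric on `ℂ`: `mem_dolbeaultHarmonicForms_iff` fails as stated

This file settles the status of the named fact
`Literature.NumberTheory.Transcendental.mem_dolbeaultHarmonicForms_iff` of
`Literature/NumberTheory/Transcendental/KaehlerHodge.lean` ("`α ∈ dolbeaultHarmonicForms o p q h ↔
IsDolbeaultHarmonic o p q h α` for `p + q = k`", i.e. the `∂̄`-harmonic `(p,q)`-forms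
`{α smooth, of type (p,q), Δ_∂̄ α = 0}` form a linear subspace; Voisin, *Hodge Theory and Complex
Algebraic Geometry I* (2002), §5.1.4, p. 124: `Δ_∂̄ = ∂̄∂̄* + ∂̄*∂̄` "acts on the `C^∞` differential
forms" as a (linear differential) operator, Def. 5.14; §6.1.2, p. 142) by an explicit, fully
computed counterexample.

## What is refuted, and why it matters

The fact was a sorried *theorem* in a section of `KaehlerHodge.lean` carrying the instances
`[IsManifold 𝓘(ℂ, E) ω M] [IsManifold 𝓘(ℝ, E) ∞ M] [IsContinuousRiemannianBundle E _]
[IsContMDiffRiemannianBundle 𝓘(ℝ, E) ∞ E _]` (holomorphic atlas, smooth metric); the M5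
migration turned it into `def … : Prop`, and a `def` does not pick up unused section instances.
As vendored it therefore binds, as regards the metric, only
`[RiemannianBundle fun x ↦ TangentSpace 𝓘(ℝ, E) x]` — Mathlib's fibrewise inner product *of no
regularity at all* — and quantifies over such metrics (`#check @mem_dolbeaultHarmonicForms_iff`).
In Voisin a Hermitian metric is `C^∞`; for rough metrics the statement is false, so
`mem_dolbeaultHarmonicForms_iff_holds` can never be proved:

* `not_forall_mem_dolbeaultHarmonicForms_iff`: the universal closure fails (already for
  `E = M = ℂ`, `n = 2`, degree `k = 0`, type `(0,0)`);
* `ShearMetric.not_mem_dolbeaultHarmonicForms_iff`: the concrete instance.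

The positive content for smooth metrics on complex manifolds is in
`Literature/NumberTheory/Transcendental/KaehlerHodgeDolbeaultHarmonicSubspaceProofs.lean`
(`mem_dolbeaultHarmonicForms_iff_of_contMDiffMetric`, and the corrected closed statement
`mem_dolbeaultHarmonicForms_iff_of_isContMDiffRiemannianBundle` with its discharge). This is the
complex counterpart of `Literature/Geometry/Kaehler/RiemannianHodgeRoughMetric.lean`, which refutes
the real analogue `Literature.Geometry.Kaehler.mem_harmonicForms_iff` (whose rational switch
`RoughMetric.switch` is reused here).

## The counterexample (`namespace ShearMetric`)

On `M = ℂ` (model `𝓘(ℝ, ℂ)`, standard orientation `stdOrientation` from `Complex.basisOneI`) take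
the *shear metric* `g = (dx + u dy)² + dy²` with `u = λ^{1/2}`, `λ (x + iy) = |switch x|`
(`= |x|` for rational `x`, `0` otherwise; `shearMetric`, a `Bundle.RiemannianMetric`; the bundle
structure `shearBundle` is a `def` used as a *local* instance only, taking precedence over Mathlib's
flat `riemannianMetricVectorSpace` instance on `ℂ`). Then:

* `λ ≥ 0`, `λ → 0` at the origin (`tendsto_lam_zero`), and `λ` — hence the trace
  `τ = tr g = 2 + u² = 2 + λ` — is differentiable at **no** point (`not_differentiableAt_lam`, from
  the one-variable `not_differentiableAt_abs_switch`). Consequently `q ↦ c(q) τ(q)` is not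
  differentiable at `p` whenever `c` is differentiable at `p` with `c(p) ≠ 0`
  (`not_differentiableAt_mul_tau`).
* `det g = 1`: the frame `(∂ₓ, ∂_y - u ∂ₓ)` is `g`-orthonormal and positively oriented, so the
  Riemannian volume form is the constant `dx ∧ dy` (`volumeFormL_eq_ΩT`) and the hypothesis
  `ho : IsSmoothForm (riemannianVolumeForm o)` of the fact holds (`isSmoothForm_riemannianVolumeForm`).
* `⋆` on real `1`-forms is `⋆dx = u dx + (1 + u²) dy`, `⋆dy = -dx - u dy` (`hodgeStar_one_apply`,
  via the Riesz vector and the proved two-dimensional check `hodgeStar_apply_eq_areaForm_holds`);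
  the `ℂ`-linear star of `c dz̄` is `c ⋆dz̄`, `⋆dz̄ = (u + i) dx + ((1 + u²) + iu) dy`
  (`cHodgeStar_cdzb`), whose `(0,1)`-part is `(iτ/2) c dz̄` (`dzbCoeff_smul_SB`: the `(0,1)`-part of
  `⋆dz̄` only sees the *trace* of `g`).
* For a function `F`, `∂̄F = F_z̄ dz̄` (`dolbeaultBar_zeroForm`, with the type decomposition
  `L = L^{1,0} + L^{0,1}` of a real-linear `L : ℂ → ℂ`, `ofSubsingleton_eq_cdz_add_cdzb`), `∂` of a
  `1`-form on `ℂ` is `(d (·)^{0,1})^{1,1}` since `(2,0)`-forms vanish (`dolbeault_one`,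
  `IsOfType.eq_zero_of_finrank_lt_left`), hence
  `Δ_∂̄ F = ∂̄*∂̄ F = -⋆ (d (G_F dz̄))^{1,1}`, `G_F = F_z̄ · iτ/2` (`dolbeaultLaplacian_zeroForm`), where
  the inner `d` is the `fderiv`-based `mextDeriv`, equal to the junk value `0` wherever `G_F dz̄` is
  not differentiable (`mextDeriv_cdzb_eq_zero`).
* For `f₁ = |z|² + z̄ + (i/2)|z|² z̄` and `f₂ = -z̄ - (i/2)|z|² z̄` one has `(f₁)_z̄ = z + 1 + i|z|²`
  and `(f₂)_z̄ = -1 - i|z|²` (`Fzb_f₁`, `Fzb_f₂`), smooth and vanishing **nowhere**, so `G_{fᵢ}` is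
  differentiable nowhere, `d (G_{fᵢ} dz̄) = 0` and `Δ_∂̄ fᵢ = 0`: both are "`∂̄`-harmonic"
  (`isDolbeaultHarmonic_f₁/₂`).
* Their sum `N = |z|²` has `N_z̄ = z`, and `G_N = (iτ/2) z` **is** differentiable at the origin with
  derivative `w ↦ i w` (`hasFDerivAt_G_Nf_zero`, since `τ → τ(0) = 2`), so
  `d (G_N dz̄)(0) = i dz ∧ dz̄ = 2 dx ∧ dy = 2 vol` (`mextDeriv_G_Nf_zero`, `re_β₀T`), which is of type
  `(1,1)`, and `Δ_∂̄ N (0) = -⋆(2 vol) = -2 ≠ 0` (`dolbeaultLaplacian_Nf_apply_zero`, using the proved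
  `⋆ vol = 1`, `hodgeStar_volumeFormL_holds`). Hence `N ∈ dolbeaultHarmonicForms` (a span) but
  `¬ IsDolbeaultHarmonic N`.

(With the diagonal metric `a dx² + a⁻¹ dy²`, `a = e^{switch x}`, of the real counterexample the
trace `a + a⁻¹ = 2 cosh (switch x)` is differentiable along `x = 0`, and the mechanism above gives
nothing at the origin; a trace continuous but non-differentiable at the origin is what is used,
whence the square root `u = |switch x|^{1/2}`, which itself never has to be differentiated: only
`u² = λ` enters `G_F`.)

## Design notes

* Analysis is done in the fixed model fibre `ℂ`, metric statements in the tangent spaces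
  `TangentSpace 𝓘(ℝ, ℂ) p` (local notation `T p`, equal to `ℂ` by definition). Covectors and the
  `2`-forms that meet metric quantities (`cdz`, `cdzb`, `ΩT`, `β₀T`) are *typed on `T p`*, values are
  moved to `ℂ` with `letI w : ℂ := v 0; …` (as in `tangentRotate_apply`), and the model-fibre copies
  (`cdzbL`, `Ωm`, `β₀`) only ever meet tangent-space types, never the metric-normed structures coming
  from `Orientation.volumeFormL` / `hodgeStar` (comparing those directly with freshly elaborated
  model types is accepted by the elaborator but makes the kernel time out).
* Forms are never compared across two different base points except through such constant model
  forms; no global instance is registered (`shearBundle` and Mathlib's `Complex.finrank_real_complex_fact`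
  are used as local instances only).
* The sibling facts `isSmoothForm_cHodgeStar`, `isSmoothForm_dolbeaultBarAdjoint`,
  `isSmoothForm_dolbeaultAdjoint`, `cmcoderiv_eq_dolbeaultAdjoint_add_dolbeaultBarAdjoint`,
  `mem_charmonicForms_iff`, `mem_charmonicForms_iff_re_im` of the same section of `KaehlerHodge.lean`
  drop the same instances; they are not treated here.

## References

* C. Voisin, *Hodge Theory and Complex Algebraic Geometry I*, Cambridge Studies in Advanced
  Mathematics 76 (2002), §5.1.4 (p. 124: the Laplacians `Δ_∂`, `Δ_∂̄` act on the `C^∞` forms — for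
  a `C^∞` Hermitian metric), Def. 5.14, §6.1.2 (p. 142). [cite: Voisin2002]
* D. Huybrechts, *Complex Geometry. An Introduction* (2005), §3.2, Def. 3.2.4.
-/

noncomputable section

open scoped Manifold ContDiff Topology ComplexConjugate
open Bundle Module Filter Set ContinuousAlternatingMap

namespace Literature.NumberTheory.Transcendental

namespace ShearMetric

open Literature.Geometry.Kaehler Literature.Geometry.Kaehler.RoughMetric

/-! ### The rough coefficient `λ = |switch x|` and the non-differentiability lemmas -/

/-- `t ↦ |switch t|` (`= |t|` on rationals, `0` on irrationals) is differentiable at no real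
point: at `t ≠ 0` it is not even continuous, at `0` its slopes are `0` along the irrationals and
`±1` along the non-zero rationals. [folklore] -/
theorem not_differentiableAt_abs_switch (t : ℝ) : ¬ DifferentiableAt ℝ (fun s ↦ |switch s|) t := by
  intro hd
  rcases eq_or_ne t 0 with rfl | ht
  · have hder := hd.hasDerivAt
    rw [hasDerivAt_iff_tendsto_slope] at hder
    set L := deriv (fun s ↦ |switch s|) 0
    have hIsub : {x : ℝ | Irrational x} ⊆ {0}ᶜ := fun x hx h0 ↦
      not_irrational_zero ((mem_singleton_iff.1 h0) ▸ hx)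
    have h1 : Tendsto (slope (fun s ↦ |switch s|) 0) (𝓝[{x | Irrational x}] 0) (𝓝 L) :=
      hder.mono_left (nhdsWithin_mono _ hIsub)
    have h1' : Tendsto (slope (fun s ↦ |switch s|) 0) (𝓝[{x | Irrational x}] 0) (𝓝 0) := by
      refine tendsto_const_nhds.congr' ?_
      filter_upwards [self_mem_nhdsWithin] with x hx
      simp [slope_def_field, switch_of_irrational hx]
    haveI : (𝓝[{x : ℝ | Irrational x}] (0 : ℝ)).NeBot :=
      mem_closure_iff_nhdsWithin_neBot.1 (dense_irrational 0)
    have hL0 : L = 0 := tendsto_nhds_unique h1 h1'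
    -- along the nonzero rationals the slopes are `±1`, of absolute value `1`
    set K : Set ℝ := Set.range ((↑) : ℚ → ℝ) \ {0}
    have h2 : Tendsto (slope (fun s ↦ |switch s|) 0) (𝓝[K] 0) (𝓝 L) :=
      hder.mono_left (nhdsWithin_mono _ (sdiff_subset_compl _ _))
    rw [hL0] at h2
    have h3 : ∀ᶠ x in 𝓝[K] 0, |slope (fun s ↦ |switch s|) 0 x| = 1 := by
      filter_upwards [self_mem_nhdsWithin] with x hx
      have hx0 : x ≠ 0 := hx.2
      have hxq : ¬ Irrational x := fun h ↦ h hx.1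
      simp only [slope_def_field, switch_of_not_irrational hxq, switch_zero, abs_zero, sub_zero,
        abs_div, abs_abs]
      exact div_self (abs_ne_zero.2 hx0)
    have h4 : ∀ᶠ x in 𝓝[K] 0, |slope (fun s ↦ |switch s|) 0 x| < 1 / 2 := by
      have := ((continuous_abs.tendsto (0 : ℝ)).comp h2).eventually
        (gt_mem_nhds (by norm_num : |(0 : ℝ)| < 1 / 2))
      exact this.mono fun x hx ↦ by simpa using hx
    haveI : (𝓝[K] (0 : ℝ)).NeBot :=
      mem_closure_iff_nhdsWithin_neBot.1 ((Rat.denseRange_cast (𝕜 := ℝ)).sdiff_singleton 0 0)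
    obtain ⟨x, hx1, hx2⟩ := (h3.and h4).exists
    rw [hx1] at hx2
    norm_num at hx2
  · have hc : Tendsto (fun s ↦ |switch s|) (𝓝 t) (𝓝 |switch t|) := hd.continuousAt
    have hq : Tendsto (fun s ↦ |switch s|) (𝓝[Set.range ((↑) : ℚ → ℝ)] t) (𝓝 |t|) := by
      refine ((continuous_abs.tendsto t).mono_left nhdsWithin_le_nhds).congr' ?_
      filter_upwards [self_mem_nhdsWithin] with x hx
      simp [switch_of_not_irrational (fun h ↦ h hx)]
    haveI : (𝓝[Set.range ((↑) : ℚ → ℝ)] t).NeBot :=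
      mem_closure_iff_nhdsWithin_neBot.1 (Rat.denseRange_cast (𝕜 := ℝ) t)
    have ht1 : |switch t| = |t| := tendsto_nhds_unique (hc.mono_left nhdsWithin_le_nhds) hq
    have hi : Tendsto (fun s ↦ |switch s|) (𝓝[{x | Irrational x}] t) (𝓝 0) := by
      refine tendsto_const_nhds.congr' ?_
      filter_upwards [self_mem_nhdsWithin] with x hx
      simp [switch_of_irrational hx]
    haveI : (𝓝[{x : ℝ | Irrational x}] t).NeBot :=
      mem_closure_iff_nhdsWithin_neBot.1 (dense_irrational t)
    have ht0 : |switch t| = 0 := tendsto_nhds_unique (hc.mono_left nhdsWithin_le_nhds) hi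
    exact ht (abs_eq_zero.1 (ht1.symm.trans ht0))

/-- The rough coefficient `λ (x + iy) = |switch x|` (`= |x|` for rational `x`, `0` otherwise):
non-negative, `≤ |x|`, continuous at the points of the imaginary axis, differentiable nowhere. [folklore] -/
def lam (p : ℂ) : ℝ := |switch p.re|

/-- `0 ≤ λ`. [folklore] -/
theorem lam_nonneg (p : ℂ) : 0 ≤ lam p := abs_nonneg _

/-- `λ = 0` on the imaginary axis. [folklore] -/
theorem lam_of_re_eq_zero {p : ℂ} (hp : p.re = 0) : lam p = 0 := by simp [lam, hp]

/-- `λ (p) ≤ ‖p‖`. [folklore] -/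
theorem lam_le_norm (p : ℂ) : lam p ≤ ‖p‖ :=
  (abs_switch_le p.re).trans (Complex.abs_re_le_norm p)

/-- `λ → 0` at the origin. [folklore] -/
theorem tendsto_lam_zero : Tendsto lam (𝓝 0) (𝓝 0) := by
  refine squeeze_zero_norm (fun p ↦ ?_) (by simpa using (continuous_norm.tendsto (0 : ℂ)))
  rw [Real.norm_eq_abs, abs_of_nonneg (lam_nonneg p)]
  exact lam_le_norm p

/-- `λ` is differentiable at no point of the plane (restrict to a horizontal line). [folklore] -/
theorem not_differentiableAt_lam (p : ℂ) : ¬ DifferentiableAt ℝ lam p := by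
  intro hd
  have hf : DifferentiableAt ℝ (fun t : ℝ ↦ ((t : ℂ) + p.im * Complex.I)) p.re :=
    (Complex.ofRealCLM.differentiableAt).add (differentiableAt_const _)
  have hp : ((p.re : ℂ) + p.im * Complex.I) = p := Complex.re_add_im p
  have h1 : DifferentiableAt ℝ (lam ∘ fun t : ℝ ↦ ((t : ℂ) + p.im * Complex.I)) p.re :=
    (hp ▸ hd).comp p.re hf
  have h3 : (lam ∘ fun t : ℝ ↦ ((t : ℂ) + p.im * Complex.I)) = fun s ↦ |switch s| := by
    funext t
    simp [lam]
  rw [h3] at h1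
  exact not_differentiableAt_abs_switch p.re h1

/-- The trace `τ = 2 + λ` of the shear metric. [folklore] -/
def tau (p : ℂ) : ℝ := 2 + lam p

/-- `τ 0 = 2`. [folklore] -/
@[simp] theorem tau_zero : tau 0 = 2 := by simp [tau, lam]

/-- `τ → 2` at the origin. [folklore] -/
theorem tendsto_tau_zero : Tendsto tau (𝓝 0) (𝓝 2) := by
  have h : tau = fun p ↦ 2 + lam p := rfl
  rw [h]
  simpa using (tendsto_const_nhds (x := (2 : ℝ))).add tendsto_lam_zero

/-- `τ` is differentiable at no point. [folklore] -/
theorem not_differentiableAt_tau (p : ℂ) : ¬ DifferentiableAt ℝ tau p := fun h ↦ by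
  have hl : lam = fun q ↦ tau q - 2 := by funext q; simp [tau]
  exact not_differentiableAt_lam p (hl ▸ h.sub_const 2)

/-- **Junk-value mechanism.** If `c` is (real-)differentiable at `p` with `c p ≠ 0`, then
`q ↦ c q · τ q` is *not* differentiable at `p` (otherwise `τ = Re (c τ c̄) / |c|²` would be). [folklore] -/
theorem not_differentiableAt_mul_tau {c : ℂ → ℂ} {p : ℂ} (hc : DifferentiableAt ℝ c p)
    (hc0 : c p ≠ 0) : ¬ DifferentiableAt ℝ (fun q ↦ c q * (tau q : ℂ)) p := by
  intro hd
  have hconj : DifferentiableAt ℝ (fun q ↦ conj (c q)) p :=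
    Complex.conjCLE.differentiableAt.comp p hc
  -- `q ↦ τ q * normSq (c q)` is differentiable (real part of `(c τ) · c̄`)
  have h1 : DifferentiableAt ℝ (fun q ↦ ((c q * (tau q : ℂ)) * conj (c q)).re) p :=
    Complex.reCLM.differentiableAt.comp p (hd.mul hconj)
  have h1' : (fun q ↦ ((c q * (tau q : ℂ)) * conj (c q)).re) = fun q ↦ tau q * Complex.normSq (c q) := by
    funext q
    rw [mul_right_comm, Complex.mul_conj]
    simp only [Complex.mul_re, Complex.ofReal_re, Complex.ofReal_im, mul_zero, sub_zero]
    ring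
  rw [h1'] at h1
  have h2 : DifferentiableAt ℝ (fun q ↦ Complex.normSq (c q)) p := by
    have : (fun q ↦ Complex.normSq (c q)) = fun q ↦ (c q * conj (c q)).re := by
      funext q; rw [Complex.mul_conj]; simp
    rw [this]
    exact Complex.reCLM.differentiableAt.comp p (hc.mul hconj)
  have h0 : Complex.normSq (c p) ≠ 0 := by simpa [Complex.normSq_eq_zero] using hc0
  have h3 : DifferentiableAt ℝ (fun q ↦ tau q * Complex.normSq (c q) * (Complex.normSq (c q))⁻¹) p :=
    h1.mul (h2.inv h0)
  have h4 : DifferentiableAt ℝ tau p := by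
    refine (h3.congr_of_eventuallyEq ?_)
    have hev : ∀ᶠ q in 𝓝 p, Complex.normSq (c q) ≠ 0 :=
      (Complex.continuous_normSq.continuousAt.comp hc.continuousAt).eventually_ne h0
    filter_upwards [hev] with q hq
    simp [mul_inv_cancel_right₀ hq]
  exact not_differentiableAt_tau p h4

/-! ### The shear metric on `ℂ` -/

-- `finrank ℝ ℂ = 2` as the `Fact` consumed by `Orientation.volumeForm`: Mathlib's
-- `Complex.finrank_real_complex_fact`, a theorem used as a *local* instance only.
attribute [local instance] Complex.finrank_real_complex_fact

local notation "T" => TangentSpace 𝓘(ℝ, ℂ)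

/-- The shear coefficient `u = λ^{1/2}` (so that `u² = λ`). [folklore] -/
def us (p : ℂ) : ℝ := Real.sqrt (lam p)

/-- `u² = λ`. [folklore] -/
theorem us_sq (p : ℂ) : us p ^ 2 = lam p := Real.sq_sqrt (lam_nonneg p)

/-- `u * u = λ`. [folklore] -/
theorem us_mul_self (p : ℂ) : us p * us p = lam p := by rw [← sq, us_sq]

/-- `0 ≤ u`. [folklore] -/
theorem us_nonneg (p : ℂ) : 0 ≤ us p := Real.sqrt_nonneg _

/-- `u 0 = 0`. [folklore] -/
@[simp] theorem us_zero : us 0 = 0 := by simp [us, lam]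

/-- The coframe covector `θ¹ = dx + u dy`. [folklore] -/
def theta1 (p : ℂ) : ℂ →L[ℝ] ℝ := Complex.reCLM + us p • Complex.imCLM

/-- `θ¹(v) = v₁ + u v₂`. [folklore] -/
@[simp] theorem theta1_apply (p : ℂ) (v : ℂ) : theta1 p v = v.re + us p * v.im := by
  simp [theta1]

/-- The shear metric `g = θ¹ ⊗ θ¹ + dy ⊗ dy = (dx + u dy)² + dy²` as a continuous bilinear form
on `ℂ = ℝ²` (unit determinant, trace `2 + u² = τ`). [folklore] -/
def metricInner (p : ℂ) : ℂ →L[ℝ] ℂ →L[ℝ] ℝ :=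
  (ContinuousLinearMap.mul ℝ ℝ).bilinearComp (theta1 p) (theta1 p) +
    (ContinuousLinearMap.mul ℝ ℝ).bilinearComp Complex.imCLM Complex.imCLM

/-- Unfolding of `metricInner`: `g(v, w) = (v₁ + u v₂)(w₁ + u w₂) + v₂ w₂`. [folklore] -/
@[simp]
theorem metricInner_apply (p : ℂ) (v w : ℂ) :
    metricInner p v w = (v.re + us p * v.im) * (w.re + us p * w.im) + v.im * w.im := by
  simp [metricInner]
  ring

set_option backward.isDefEq.respectTransparency false in
/-- The rough shear metric on the tangent spaces of `ℂ` (Mathlib's `Bundle.RiemannianMetric`: no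
regularity in the base point is required, and none holds). [folklore] -/
def shearMetric : RiemannianMetric (fun x : ℂ ↦ T x) where
  inner p := (metricInner p : ℂ →L[ℝ] ℂ →L[ℝ] ℝ)
  symm p v w := by
    change metricInner p v w = metricInner p w v
    rw [metricInner_apply, metricInner_apply]
    ring
  pos p v hv := by
    change 0 < metricInner p v v
    rw [metricInner_apply]
    have : (v : ℂ).re ≠ 0 ∨ (v : ℂ).im ≠ 0 := by
      by_contra h
      simp only [not_or, not_not] at h
      exact hv (Complex.ext h.1 h.2)
    rcases this with h | h
    · by_cases hi : (v : ℂ).im = 0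
      · simp only [hi, mul_zero, add_zero]
        exact mul_self_pos.2 h
      · nlinarith [mul_self_nonneg ((v : ℂ).re + us p * (v : ℂ).im), mul_self_pos.2 hi]
    · nlinarith [mul_self_nonneg ((v : ℂ).re + us p * (v : ℂ).im), mul_self_pos.2 h]
  continuousAt p := by
    change ContinuousAt (fun v : ℂ ↦ metricInner p v v) 0
    exact ((metricInner p).continuous₂.comp (continuous_id.prodMk continuous_id)).continuousAt
  isVonNBounded p := by
    change Bornology.IsVonNBounded ℝ {v : ℂ | metricInner p v v < 1}
    refine (NormedSpace.isVonNBounded_closedBall ℝ ℂ (2 + us p)).subset ?_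
    intro v hv
    simp only [mem_setOf_eq, metricInner_apply] at hv
    simp only [Metric.mem_closedBall, dist_zero_right]
    have hu : 0 ≤ us p := us_nonneg p
    have h1 : v.im * v.im < 1 := by nlinarith [mul_self_nonneg (v.re + us p * v.im)]
    have h2 : (v.re + us p * v.im) * (v.re + us p * v.im) < 1 := by
      nlinarith [mul_self_nonneg v.im]
    have him : |v.im| < 1 := by nlinarith [abs_mul_abs_self v.im, abs_nonneg v.im]
    have hre' : |v.re + us p * v.im| < 1 := by
      nlinarith [abs_mul_abs_self (v.re + us p * v.im), abs_nonneg (v.re + us p * v.im)]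
    have hre : |v.re| ≤ 1 + us p := by
      have := abs_add_le (v.re + us p * v.im) (-(us p * v.im))
      simp only [add_neg_cancel_right, abs_neg, abs_mul, abs_of_nonneg hu] at this
      nlinarith [abs_nonneg v.im, mul_le_mul_of_nonneg_left him.le hu]
    calc ‖v‖ ≤ |v.re| + |v.im| := Complex.norm_le_abs_re_add_abs_im v
      _ ≤ 2 + us p := by linarith [him.le]

/-- The rough Riemannian bundle structure on the tangent spaces of `ℂ` (a `def`, used as a
*local* instance in this file only; it takes precedence over Mathlib's flat
`RiemannianBundle (fun x : ℂ ↦ TangentSpace 𝓘(ℝ, ℂ) x)` of `riemannianMetricVectorSpace`). [folklore] -/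
@[reducible] def shearBundle : RiemannianBundle (fun x : ℂ ↦ T x) := ⟨shearMetric⟩

attribute [local instance] shearBundle

/-- The inner product of the local Riemannian structure is `metricInner` (by construction). [folklore] -/
theorem inner_eq (p : ℂ) (v w : T p) : inner ℝ v w = metricInner p v w := rfl

/-- The frame vector `e₁ = ∂ₓ = 1`. [folklore] -/
def e₁ (p : ℂ) : T p := (1 : ℂ)

/-- The frame vector `e₂ = ∂_y - u ∂ₓ = -u + i`. [folklore] -/
def e₂ (p : ℂ) : T p := (⟨-us p, 1⟩ : ℂ)

/-- Coordinates of `e₁`. [folklore] -/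
@[simp] theorem re_e₁ (p : ℂ) : Complex.re (e₁ p) = 1 := rfl
/-- Coordinates of `e₁`. [folklore] -/
@[simp] theorem im_e₁ (p : ℂ) : Complex.im (e₁ p) = 0 := rfl
/-- Coordinates of `e₂`. [folklore] -/
@[simp] theorem re_e₂ (p : ℂ) : Complex.re (e₂ p) = -us p := rfl
/-- Coordinates of `e₂`. [folklore] -/
@[simp] theorem im_e₂ (p : ℂ) : Complex.im (e₂ p) = 1 := rfl

/-- Frame decomposition of a tangent vector: `v = (v₁ + u v₂) e₁ + v₂ e₂`. [folklore] -/
theorem eq_smul_e₁_add_smul_e₂ (p : ℂ) (v : T p) :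
    v = (Complex.re v + us p * Complex.im v) • e₁ p + Complex.im v • e₂ p := by
  change (show ℂ from v) =
    (Complex.re v + us p * Complex.im v) • (1 : ℂ) + Complex.im v • (⟨-us p, 1⟩ : ℂ)
  refine Complex.ext ?_ ?_
  · simp only [Complex.add_re, Complex.smul_re, Complex.one_re, smul_eq_mul]
    ring
  · simp only [Complex.add_im, Complex.smul_im, Complex.one_im, smul_eq_mul]
    ring

/-- The frame `(e₁, e₂)`. [folklore] -/
def frame (p : ℂ) : Fin 2 → T p := ![e₁ p, e₂ p]

/-- The frame `(e₁, e₂) = (∂ₓ, ∂_y - u ∂ₓ)` is `g`-orthonormal. [folklore] -/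
theorem orthonormal_frame (p : ℂ) : Orthonormal ℝ (frame p) := by
  rw [orthonormal_iff_ite]
  intro i j
  fin_cases i <;> fin_cases j <;>
    · rw [inner_eq, metricInner_apply]
      simp [frame]

/-- The tangent spaces of the plane are `2`-dimensional. [folklore] -/
theorem finrank_tangentSpace (p : ℂ) : finrank ℝ (T p) = 2 := Complex.finrank_real_complex

/-- The frame as an orthonormal basis of the tangent space at `p`. [folklore] -/
def onb (p : ℂ) : OrthonormalBasis (Fin 2) ℝ (T p) :=
  (basisOfOrthonormalOfCardEqFinrank (orthonormal_frame p)
    (by rw [finrank_tangentSpace]; simp)).toOrthonormalBasis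
    (by simpa using orthonormal_frame p)

/-- The orthonormal basis is the frame. [folklore] -/
@[simp]
theorem onb_apply (p : ℂ) : ⇑(onb p) = frame p := by
  simp [onb]

/-- `g(e₁, v) = v₁ + u v₂ = θ¹(v)`. [folklore] -/
theorem inner_e₁ (p : ℂ) (v : T p) :
    inner ℝ (e₁ p) v = Complex.re v + us p * Complex.im v := by
  rw [inner_eq, metricInner_apply]
  simp

/-- `g(e₂, v) = v₂`. [folklore] -/
theorem inner_e₂ (p : ℂ) (v : T p) : inner ℝ (e₂ p) v = Complex.im v := by
  rw [inner_eq, metricInner_apply]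
  simp

/-- The vector `i = ∂_y` in the tangent space at `p`. [folklore] -/
def eI (p : ℂ) : T p := (Complex.I : ℂ)

/-- Coordinates of `i`. [folklore] -/
@[simp] theorem re_eI (p : ℂ) : Complex.re (eI p) = 0 := rfl
/-- Coordinates of `i`. [folklore] -/
@[simp] theorem im_eI (p : ℂ) : Complex.im (eI p) = 1 := rfl

/-- The standard basis `(1, i)` of the tangent space at `p` (Mathlib's `Complex.basisOneI`). [folklore] -/
def stdBasis (p : ℂ) : Module.Basis (Fin 2) ℝ (T p) := Complex.basisOneI

/-- The standard basis is `(1, i) = (e₁, eI)`. [folklore] -/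
theorem stdBasis_apply (p : ℂ) : ⇑(stdBasis p) = ![e₁ p, eI p] :=
  Complex.coe_basisOneI

/-- The standard orientation of `ℂ`, on every tangent space. [folklore] -/
def stdOrientation : (x : ℂ) → Orientation ℝ (T x) (Fin 2) :=
  fun p ↦ (stdBasis p).orientation

/-- The determinant of the orthonormal frame is the standard area form `v₁ w₂ - v₂ w₁`
(the frame is obtained from `(∂ₓ, ∂_y)` by a unipotent shear). [folklore] -/
theorem det_onb (p : ℂ) (v w : T p) :
    (onb p).toBasis.det ![v, w] =
      Complex.re v * Complex.im w - Complex.im v * Complex.re w := by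
  rw [Module.Basis.det_apply, Matrix.det_fin_two]
  simp only [Module.Basis.toMatrix_apply, OrthonormalBasis.coe_toBasis_repr_apply,
    OrthonormalBasis.repr_apply_apply, onb_apply, frame]
  simp [inner_e₁, inner_e₂]
  ring

/-- The frame is positively oriented for the standard orientation. [folklore] -/
theorem orientation_onb (p : ℂ) : (onb p).toBasis.orientation = stdOrientation p := by
  rw [stdOrientation, Module.Basis.orientation_eq_iff_det_pos, stdBasis_apply, det_onb]
  simp

/-- The Riemannian volume form of the shear metric is the standard area form at every point. [folklore] -/
theorem volumeForm_apply (p : ℂ) (v w : T p) :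
    (stdOrientation p).volumeForm ![v, w] =
      Complex.re v * Complex.im w - Complex.im v * Complex.re w := by
  rw [Orientation.volumeForm_robust (stdOrientation p) (onb p) (orientation_onb p), det_onb]

/-! ### The Hodge star of the shear metric on real `1`-forms -/

/-- The Riesz representative of a covector `ℓ`: `ℓ(e₁) e₁ + ℓ(e₂) e₂`. [folklore] -/
def riesz (p : ℂ) (ℓ : T p →L[ℝ] ℝ) : T p :=
  (⟨ℓ (e₁ p) - us p * ℓ (e₂ p), ℓ (e₂ p)⟩ : ℂ)

/-- `riesz p ℓ` represents `ℓ`: `g(riesz ℓ, ·) = ℓ`. [folklore] -/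
theorem innerSL_riesz (p : ℂ) (ℓ : T p →L[ℝ] ℝ) : innerSL ℝ (riesz p ℓ) = ℓ := by
  ext v
  rw [innerSL_apply_apply, inner_eq, metricInner_apply]
  conv_rhs => rw [eq_smul_e₁_add_smul_e₂ p v]
  simp only [riesz, map_add, map_smul, smul_eq_mul]
  ring

/-- **The Hodge star of the shear metric on real `1`-forms**, for the `1`-form attached to a
covector `ℓ`: `(⋆ℓ)(w) = (ℓ(e₁) - u ℓ(e₂)) w₂ - ℓ(e₂) w₁`, i.e. `⋆dx = u dx + (1 + u²) dy`,
`⋆dy = -dx - u dy` (from the Riesz vector `ℓ(e₁) e₁ + ℓ(e₂) e₂` and the proved two-dimensional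
check `hodgeStar_apply_eq_areaForm_holds`). [folklore] -/
theorem hodgeStar_ofSubsingleton_apply (p : ℂ) (h : 1 + 1 = 2) (ℓ : T p →L[ℝ] ℝ) (w : T p) :
    hodgeStar (stdOrientation p) h (ofSubsingleton ℝ (T p) ℝ (0 : Fin 1) ℓ) ![w] =
      (ℓ (e₁ p) - us p * ℓ (e₂ p)) * Complex.im w - ℓ (e₂ p) * Complex.re w := by
  rw [← innerSL_riesz p ℓ, hodgeStar_apply_eq_areaForm_holds (stdOrientation p) h,
    Orientation.areaForm_to_volumeForm, volumeForm_apply, innerSL_riesz]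
  simp [riesz]

/-- The Hodge star of the shear metric on an arbitrary real `1`-form `φ`:
`(⋆φ)(w) = (φ(e₁) - u φ(e₂)) w₂ - φ(e₂) w₁`. [folklore] -/
theorem hodgeStar_one_apply (p : ℂ) (h : 1 + 1 = 2) (φ : T p [⋀^Fin 1]→L[ℝ] ℝ) (w : T p) :
    hodgeStar (stdOrientation p) h φ ![w] =
      (φ ![e₁ p] - us p * φ ![e₂ p]) * Complex.im w - φ ![e₂ p] * Complex.re w := by
  obtain ⟨ℓ, rfl⟩ : ∃ ℓ : T p →L[ℝ] ℝ, φ = ofSubsingleton ℝ (T p) ℝ (0 : Fin 1) ℓ :=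
    ⟨(ofSubsingleton ℝ (T p) ℝ (0 : Fin 1)).symm φ, by simp⟩
  rw [hodgeStar_ofSubsingleton_apply]
  simp


/-! ### Forms on the flat plane `ℂ` -/

/-- In the flat case the chart representative of a form is the form itself. [folklore] -/
theorem inChart_eq_self {F : Type*} [NormedAddCommGroup F] [NormedSpace ℝ F] {k : ℕ}
    (α : MForm 𝓘(ℝ, ℂ) ℂ F k) (x : ℂ) : α.inChart x = α := by
  funext y
  ext v
  simp [MForm.inChart_apply]
  rfl

/-- A form on the flat plane as a plain map into the fixed model fibre (the identity, retyped:
`TangentSpace 𝓘(ℝ, ℂ) x` is `ℂ` by definition). [folklore] -/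
def flat {F : Type*} [NormedAddCommGroup F] [NormedSpace ℝ F] {k : ℕ} (α : MForm 𝓘(ℝ, ℂ) ℂ F k) :
    ℂ → ℂ [⋀^Fin k]→L[ℝ] F := α

/-- In the flat case, chart-wise smoothness is plain smoothness. [folklore] -/
theorem isSmoothForm_of_contDiff {F : Type*} [NormedAddCommGroup F] [NormedSpace ℝ F] {k : ℕ}
    {α : MForm 𝓘(ℝ, ℂ) ℂ F k} (hα : ContDiff ℝ ∞ (flat α)) : IsSmoothForm α := by
  intro x
  rw [inChart_eq_self]
  exact hα.contDiffAt.contDiffWithinAt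

/-- The complex `0`-form attached to a function `F : ℂ → ℂ`. [folklore] -/
def zeroForm (F : ℂ → ℂ) : MForm 𝓘(ℝ, ℂ) ℂ ℂ 0 :=
  fun x ↦ constOfIsEmpty ℝ (T x) (Fin 0) (F x)

/-- Evaluation of `zeroForm`. [folklore] -/
@[simp] theorem zeroForm_apply (F : ℂ → ℂ) (x : ℂ) (v : Fin 0 → T x) :
    zeroForm F x v = F x := rfl

/-- `zeroForm` is additive. [folklore] -/
theorem zeroForm_add (F G : ℂ → ℂ) : zeroForm (F + G) = zeroForm F + zeroForm G := by
  funext x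
  ext v
  simp

/-- The `0`-form of a smooth function is a smooth form. [folklore] -/
theorem isSmoothForm_zeroForm {F : ℂ → ℂ} (hF : ContDiff ℝ ∞ F) : IsSmoothForm (zeroForm F) :=
  isSmoothForm_of_contDiff ((constOfIsEmptyLIE ℝ ℂ ℂ (Fin 0)).contDiff.comp hF)

/-- Every complex `0`-form is of type `(0,0)`. [folklore] -/
theorem isOfType_zeroForm (F : ℂ → ℂ) : IsOfType 0 0 (zeroForm F) :=
  ⟨rfl, fun x θ v ↦ by simp⟩

/-- The complex `1`-form attached to a family of real-linear maps `ℂ → ℂ`. [folklore] -/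
def oneForm (ℓ : ℂ → ℂ →L[ℝ] ℂ) : MForm 𝓘(ℝ, ℂ) ℂ ℂ 1 :=
  fun x ↦ ofSubsingleton ℝ (T x) ℂ (0 : Fin 1) (ℓ x)

/-- Evaluation of `oneForm`. [folklore] -/
@[simp] theorem oneForm_apply (ℓ : ℂ → ℂ →L[ℝ] ℂ) (x : ℂ) (v : Fin 1 → T x) :
    oneForm ℓ x v = (letI w : ℂ := v 0; ℓ x w) := rfl

/-- `d` of the `0`-form of `F` is the `1`-form of `fderiv ℝ F` (Mathlib's
`extDeriv_constOfIsEmpty`, through `mextDeriv_eq_extDeriv`). [folklore] -/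
theorem mextDeriv_zeroForm (F : ℂ → ℂ) : mextDeriv (zeroForm F) = oneForm (fderiv ℝ F) := by
  funext x
  rw [mextDeriv_eq_extDeriv]
  exact extDeriv_constOfIsEmpty F x

/-! ### The type decomposition of complex `1`-forms on `ℂ`: `dz` and `dz̄` parts -/

/-- Complex conjugation as a real continuous linear map. [folklore] -/
abbrev conjL : ℂ →L[ℝ] ℂ := Complex.conjCLE.toContinuousLinearMap

/-- The `(1,0)`-covector `a dz : w ↦ a w` at the point `p`. [folklore] -/
def cdz (p : ℂ) (a : ℂ) : T p [⋀^Fin 1]→L[ℝ] ℂ :=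
  ofSubsingleton ℝ (T p) ℂ (0 : Fin 1) (a • (ContinuousLinearMap.id ℝ ℂ : T p →L[ℝ] ℂ))

/-- The `(0,1)`-covector `b dz̄ : w ↦ b w̄` at the point `p`. [folklore] -/
def cdzb (p : ℂ) (b : ℂ) : T p [⋀^Fin 1]→L[ℝ] ℂ :=
  ofSubsingleton ℝ (T p) ℂ (0 : Fin 1) (b • (conjL : T p →L[ℝ] ℂ))

/-- `(a dz)(w) = a w`. [folklore] -/
@[simp] theorem cdz_apply (p a : ℂ) (v : Fin 1 → T p) :
    cdz p a v = (letI w : ℂ := v 0; a * w) := rfl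

/-- `(b dz̄)(w) = b w̄`. [folklore] -/
@[simp] theorem cdzb_apply (p b : ℂ) (v : Fin 1 → T p) :
    cdzb p b v = (letI w : ℂ := v 0; b * conj w) := rfl

/-- `conj e₁ = 1`. [folklore] -/
@[simp] theorem conj_e₁ (p : ℂ) : (letI w : ℂ := e₁ p; conj w) = 1 := by
  change conj (1 : ℂ) = 1
  simp

/-- `conj e₂ = -u - i`. [folklore] -/
@[simp] theorem conj_e₂ (p : ℂ) : (letI w : ℂ := e₂ p; conj w) = (⟨-us p, -1⟩ : ℂ) := by
  change conj (⟨-us p, 1⟩ : ℂ) = _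
  exact Complex.ext (by simp) (by simp)

/-- `b ↦ b dz̄` as a real continuous linear map into the model fibre (for the chain rule). [folklore] -/
def cdzbL : ℂ →L[ℝ] (ℂ [⋀^Fin 1]→L[ℝ] ℂ) :=
  LinearMap.toContinuousLinearMap
    { toFun := fun b ↦ ofSubsingleton ℝ ℂ ℂ (0 : Fin 1) (b • conjL)
      map_add' := fun b b' ↦ by ext v; simp [add_mul]
      map_smul' := fun r b ↦ by ext v; simp [mul_assoc] }

/-- `cdzbL b` is `b dz̄` (at any point; the tangent spaces are the model fibre `ℂ`). [folklore] -/
theorem cdzbL_apply (p b : ℂ) : cdzbL b = cdzb p b := rfl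

/-- The `dz`-coefficient `(L(1) - i L(i))/2` of a real-linear map `L : ℂ → ℂ`. [folklore] -/
def dzCoeff (L : ℂ →L[ℝ] ℂ) : ℂ := (L 1 - Complex.I * L Complex.I) / 2

/-- The `dz̄`-coefficient `(L(1) + i L(i))/2` of a real-linear map `L : ℂ → ℂ`. [folklore] -/
def dzbCoeff (L : ℂ →L[ℝ] ℂ) : ℂ := (L 1 + Complex.I * L Complex.I) / 2

/-- A real-linear map `L : ℂ → ℂ` in real coordinates: `L(x + iy) = x L(1) + y L(i)`. [folklore] -/
theorem clm_apply_eq (L : ℂ →L[ℝ] ℂ) (w : ℂ) :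
    L w = (w.re : ℂ) * L 1 + (w.im : ℂ) * L Complex.I := by
  conv_lhs => rw [← Complex.re_add_im w]
  have h1 : L (w.re : ℂ) = (w.re : ℂ) * L 1 := by
    simpa [Complex.real_smul] using L.map_smul w.re (1 : ℂ)
  have h2 : L ((w.im : ℂ) * Complex.I) = (w.im : ℂ) * L Complex.I := by
    simpa [Complex.real_smul] using L.map_smul w.im Complex.I
  rw [map_add, h1, h2]

/-- **Type decomposition of a real-linear map** `L : ℂ → ℂ` (as a complex `1`-covector at `p`):
`L(w) = ((L1 - iLi)/2) w + ((L1 + iLi)/2) w̄`, i.e. `L = L^{1,0} + L^{0,1}`. [folklore] -/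
theorem ofSubsingleton_eq_cdz_add_cdzb (p : ℂ) (L : ℂ →L[ℝ] ℂ) :
    ofSubsingleton ℝ (T p) ℂ (0 : Fin 1) (L : T p →L[ℝ] ℂ) =
      cdz p (dzCoeff L) + cdzb p (dzbCoeff L) := by
  ext v
  simp only [ofSubsingleton_apply_apply, ContinuousAlternatingMap.add_apply, cdz_apply, cdzb_apply,
    dzCoeff, dzbCoeff]
  change L (v 0) = _
  rw [clm_apply_eq L (v 0), ← Complex.re_add_im (v 0)]
  simp only [map_add, map_mul, Complex.conj_ofReal, Complex.conj_I, Complex.add_re,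
    Complex.ofReal_re, Complex.mul_re, Complex.I_re, Complex.I_im, Complex.ofReal_im,
    Complex.add_im, Complex.mul_im, mul_zero, mul_one, zero_add, add_zero, sub_self]
  linear_combination ((Complex.im (v 0) : ℂ) * L Complex.I) * Complex.I_sq

/-- `a dz` is of type `(1,0)`: `a (e^{iθ} w) = e^{iθ} (a w)`. [folklore] -/
theorem isOfType_cdz (a : ℂ → ℂ) : IsOfType 1 0 (fun p ↦ cdz p (a p)) := by
  refine ⟨rfl, fun x θ v ↦ ?_⟩
  simp only [cdz_apply, tangentRotate_apply, smul_eq_mul]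
  push_cast
  ring_nf

/-- `b dz̄` is of type `(0,1)`: `b \overline{e^{iθ} w} = e^{-iθ} (b w̄)`. [folklore] -/
theorem isOfType_cdzb (b : ℂ → ℂ) : IsOfType 0 1 (fun p ↦ cdzb p (b p)) := by
  refine ⟨rfl, fun x θ v ↦ ?_⟩
  simp only [cdzb_apply, tangentRotate_apply, smul_eq_mul, map_mul, ← Complex.exp_conj,
    Complex.conj_ofReal, Complex.conj_I]
  push_cast
  ring_nf

/-- **The `(0,1)`-part of a complex `1`-form on `ℂ`**: `(oneForm ℓ)^{0,1} = (dz̄Coeff ℓ) dz̄`. [folklore] -/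
theorem typeComponent_zero_one_oneForm (ℓ : ℂ → ℂ →L[ℝ] ℂ) :
    (oneForm ℓ).typeComponent 0 1 = fun p ↦ cdzb p (dzbCoeff (ℓ p)) := by
  have h : oneForm ℓ = (fun p ↦ cdz p (dzCoeff (ℓ p))) + fun p ↦ cdzb p (dzbCoeff (ℓ p)) := by
    funext p
    exact ofSubsingleton_eq_cdz_add_cdzb p (ℓ p)
  rw [h, MForm.typeComponent_add,
    IsOfType.typeComponent_of_ne_holds (isOfType_cdz _) (Or.inl one_ne_zero),
    (isOfType_cdzb _).typeComponent_eq_self, zero_add]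

/-- The `z̄`-derivative `F_z̄ = (F_x + i F_y)/2` of `F : ℂ → ℂ` (the `dz̄`-coefficient of its real
derivative; junk where `F` is not differentiable). [folklore] -/
def Fzb (F : ℂ → ℂ) (p : ℂ) : ℂ := dzbCoeff (fderiv ℝ F p)

/-- **`∂̄` of a complex function on `ℂ`**: `∂̄F = F_z̄ dz̄` (the `(0,1)`-part of `dF`). [folklore] -/
theorem dolbeaultBar_zeroForm (F : ℂ → ℂ) :
    dolbeaultBar (zeroForm F) = fun p ↦ cdzb p (Fzb F p) := by
  rw [IsOfType.dolbeaultBar_eq_holds (isOfType_zeroForm F), mextDeriv_zeroForm,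
    typeComponent_zero_one_oneForm]
  rfl

/-! ### The complex Hodge star of the shear metric on `(0,1)`-forms -/

/-- The covector `⋆dz̄ = ⋆dx - i ⋆dy : w ↦ (u + i) w₁ + ((1 + u²) + iu) w₂` of the shear metric. [folklore] -/
def SB (p : ℂ) : ℂ →L[ℝ] ℂ :=
  Complex.reCLM.smulRight ((us p : ℂ) + Complex.I) +
    Complex.imCLM.smulRight ((1 : ℂ) + lam p + Complex.I * us p)

/-- Evaluation of `⋆dz̄`. [folklore] -/
@[simp] theorem SB_apply (p w : ℂ) :
    SB p w = (w.re : ℂ) * ((us p : ℂ) + Complex.I) +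
      (w.im : ℂ) * ((1 : ℂ) + lam p + Complex.I * us p) := by
  simp [SB, Complex.real_smul]
  ring

/-- **The complex Hodge star of `c dz̄`** for the shear metric: `⋆(c dz̄) = c ⋆dz̄` with
`⋆dz̄ = (u + i) dx + ((1 + u²) + iu) dy` (the `ℂ`-linear extension of the real star,
`hodgeStar_one_apply`, applied to `Re (c dz̄)` and `Im (c dz̄)`). [folklore] -/
theorem cHodgeStar_cdzb (h : 1 + 1 = 2) (c : ℂ → ℂ) :
    MForm.cHodgeStar stdOrientation h (fun p ↦ cdzb p (c p)) = oneForm (fun p ↦ c p • SB p) := by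
  funext p
  ext v
  have hv : v = ![v 0] := by
    funext i
    fin_cases i
    rfl
  rw [MForm.cHodgeStar_apply]
  simp only [Pi.add_apply, Pi.smul_apply, ContinuousAlternatingMap.add_apply,
    ContinuousAlternatingMap.smul_apply, MForm.ofReal_apply, MForm.hodgeStar_apply]
  rw [hv, hodgeStar_one_apply, hodgeStar_one_apply]
  simp only [MForm.re_apply, MForm.im_apply, oneForm_apply, Matrix.cons_val_zero,
    _root_.smul_apply, SB_apply, smul_eq_mul, cdzb_apply, conj_e₁, conj_e₂, mul_one]
  apply Complex.ext
  · simp only [Complex.add_re, Complex.ofReal_re, Complex.mul_re, Complex.I_re, Complex.I_im,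
      Complex.ofReal_im, Complex.add_im, Complex.mul_im, Complex.one_re, Complex.one_im]
    rw [← us_mul_self]
    ring
  · simp only [Complex.add_re, Complex.ofReal_re, Complex.mul_re, Complex.I_re, Complex.I_im,
      Complex.ofReal_im, Complex.add_im, Complex.mul_im, Complex.one_re, Complex.one_im]
    rw [← us_mul_self]
    ring

/-- The `dz̄`-coefficient of `c ⋆dz̄` is `c · iτ/2` (`τ = 2 + u²` the trace of the metric):
`(⋆dz̄)^{0,1} = (i/2) tr(g) dz̄`. [folklore] -/
theorem dzbCoeff_smul_SB (p : ℂ) (c : ℂ) :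
    dzbCoeff (c • SB p) = c * ((tau p : ℂ) * (Complex.I / 2)) := by
  simp only [dzbCoeff, _root_.smul_apply, SB_apply, smul_eq_mul, tau]
  simp only [Complex.one_re, Complex.one_im, Complex.I_re, Complex.I_im, Complex.ofReal_zero,
    Complex.ofReal_one, zero_mul, one_mul, add_zero, zero_add]
  push_cast
  linear_combination (c * us p / 2) * Complex.I_sq

/-! ### `∂` of a complex `1`-form on `ℂ`: only `(d α^{0,1})^{1,1}` survives -/

/-- On `ℂ` there are no `(2,0)`-forms: the `(2,0)`-component of any complex `2`-form vanishes
(`IsOfType.eq_zero_of_finrank_lt_left`, `dim_ℂ ℂ = 1 < 2`). [folklore] -/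
theorem typeComponent_two_zero_eq_zero (β : MForm 𝓘(ℝ, ℂ) ℂ ℂ (1 + 1)) :
    β.typeComponent 2 0 = 0 :=
  (isOfType_typeComponent_holds (show 2 + 0 = 1 + 1 by rfl) β).eq_zero_of_finrank_lt_left
    (by simp)

/-- **`∂` of a complex `1`-form `α` on `ℂ`** reduces to `(d α^{0,1})^{1,1}`: the other summand
`(d α^{1,0})^{2,0}` of `∂α = ∑_{p+q=1} (d α^{p,q})^{p+1,q}` is a `(2,0)`-form, hence `0`. [folklore] -/
theorem dolbeault_one (α : MForm 𝓘(ℝ, ℂ) ℂ ℂ 1) :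
    dolbeault α = (mextDeriv (α.typeComponent 0 1)).typeComponent 1 1 := by
  rw [dolbeault, Finset.Nat.sum_antidiagonal_succ]
  simp [typeComponent_two_zero_eq_zero]

/-! ### The `∂̄`-Laplacian of a function for the shear metric -/

/-- The coefficient `G_F = F_z̄ · iτ/2` of `(⋆∂̄F)^{0,1} = G_F dz̄`. [folklore] -/
def G (F : ℂ → ℂ) (p : ℂ) : ℂ := Fzb F p * ((tau p : ℂ) * (Complex.I / 2))

/-- **`Δ_∂̄ F = -⋆ (d (G_F dz̄))^{1,1}`**, `G_F = F_z̄ · iτ/2`, for a complex function `F` on `ℂ`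
with the shear metric: `Δ_∂̄ F = ∂̄*∂̄F = -⋆∂⋆(F_z̄ dz̄)`, `⋆(F_z̄ dz̄) = F_z̄ ⋆dz̄`,
`(F_z̄ ⋆dz̄)^{0,1} = (iτ/2) F_z̄ dz̄`, and `∂` of a `1`-form is `(d (·)^{0,1})^{1,1}`. The inner `d`
is the junk-valued `mextDeriv`. [folklore] -/
theorem dolbeaultLaplacian_zeroForm (h : 0 + 2 = 2) (F : ℂ → ℂ) :
    dolbeaultLaplacian stdOrientation 0 2 h (zeroForm F) =
      -MForm.cHodgeStar stdOrientation (show (1 + 1) + 0 = 2 by rfl)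
        ((mextDeriv (fun p ↦ cdzb p (G F p))).typeComponent 1 1) := by
  simp only [dolbeaultLaplacian, dolbeaultBarAdjoint]
  rw [dolbeaultBar_zeroForm, cHodgeStar_cdzb, dolbeault_one, typeComponent_zero_one_oneForm]
  simp only [dzbCoeff_smul_SB, G]


/-! ### Junk values: `d (G dz̄) = 0` when `G` is differentiable nowhere -/

/-- The manifold exterior derivative of the `(0,1)`-form `G dz̄` vanishes identically when the
coefficient `G` is differentiable at no point (`fderiv` is `0` at points of
non-differentiability). [folklore] -/
theorem mextDeriv_cdzb_eq_zero {Gf : ℂ → ℂ} (hG : ∀ p, ¬ DifferentiableAt ℝ Gf p) :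
    mextDeriv (fun p ↦ cdzb p (Gf p)) = 0 := by
  have hnd : ∀ p, ¬ DifferentiableAt ℝ (fun q ↦ cdzbL (Gf q)) p := by
    intro p hd
    apply hG p
    have h1 : DifferentiableAt ℝ
        (⇑(ContinuousAlternatingMap.apply ℝ ℂ ℂ ![(1 : ℂ)]) ∘ fun q ↦ cdzbL (Gf q)) p :=
      (ContinuousLinearMap.differentiableAt _).comp p hd
    have h2 : (⇑(ContinuousAlternatingMap.apply ℝ ℂ ℂ ![(1 : ℂ)]) ∘ fun q ↦ cdzbL (Gf q)) = Gf := by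
      funext q
      simp [cdzbL]
    rwa [h2] at h1
  funext p
  rw [mextDeriv_eq_extDeriv, Pi.zero_apply]
  change alternatizeUncurryFin (fderiv ℝ (fun q ↦ cdzbL (Gf q)) p) =
    (0 : ℂ [⋀^Fin (1 + 1)]→L[ℝ] ℂ)
  rw [fderiv_zero_of_not_differentiableAt (hnd p)]
  ext v
  simp [alternatizeUncurryFin_apply]

/-- **Junk harmonicity.** If `F_z̄` is differentiable and vanishes nowhere, then
`G_F = F_z̄ · iτ/2` is differentiable nowhere (`not_differentiableAt_mul_tau`), so
`d (G_F dz̄) = 0` and `Δ_∂̄ F = 0` for the shear metric. [folklore] -/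
theorem dolbeaultLaplacian_zeroForm_eq_zero (h : 0 + 2 = 2) {F : ℂ → ℂ}
    (hd : ∀ p, DifferentiableAt ℝ (Fzb F) p) (h0 : ∀ p, Fzb F p ≠ 0) :
    dolbeaultLaplacian stdOrientation 0 2 h (zeroForm F) = 0 := by
  rw [dolbeaultLaplacian_zeroForm, mextDeriv_cdzb_eq_zero, MForm.typeComponent_zero,
    _root_.map_zero, neg_zero]
  intro p
  have hG : G F = fun q ↦ (Fzb F q * (Complex.I / 2)) * (tau q : ℂ) := by
    funext q
    simp only [G]
    ring
  rw [hG]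
  exact not_differentiableAt_mul_tau ((hd p).mul_const _)
    (mul_ne_zero (h0 p) (div_ne_zero Complex.I_ne_zero two_ne_zero))

/-! ### The `dz̄`-coefficients of the derivatives of the three functions -/

/-- `dz̄Coeff` is additive. [folklore] -/
theorem dzbCoeff_add (L L' : ℂ →L[ℝ] ℂ) : dzbCoeff (L + L') = dzbCoeff L + dzbCoeff L' := by
  simp only [dzbCoeff, _root_.add_apply]
  ring

/-- `dz̄Coeff` is `ℂ`-homogeneous. [folklore] -/
theorem dzbCoeff_smul (a : ℂ) (L : ℂ →L[ℝ] ℂ) : dzbCoeff (a • L) = a * dzbCoeff L := by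
  simp only [dzbCoeff, _root_.smul_apply, smul_eq_mul]
  ring

/-- `dz̄Coeff (-L) = -dz̄Coeff L`. [folklore] -/
theorem dzbCoeff_neg (L : ℂ →L[ℝ] ℂ) : dzbCoeff (-L) = -dzbCoeff L := by
  simp only [dzbCoeff, _root_.neg_apply]
  ring

/-- `dz̄Coeff (L - L') = dz̄Coeff L - dz̄Coeff L'`. [folklore] -/
theorem dzbCoeff_sub (L L' : ℂ →L[ℝ] ℂ) : dzbCoeff (L - L') = dzbCoeff L - dzbCoeff L' := by
  simp only [dzbCoeff, _root_.sub_apply]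
  ring

/-- `dz̄Coeff (w ↦ w̄) = 1` (`dz̄` itself). [folklore] -/
@[simp] theorem dzbCoeff_conjL : dzbCoeff conjL = 1 := by
  simp [dzbCoeff]

/-- `dz̄Coeff (w ↦ w) = 0` (`dz` has no `dz̄`-part). [folklore] -/
@[simp] theorem dzbCoeff_id : dzbCoeff (ContinuousLinearMap.id ℝ ℂ) = 0 := by
  simp [dzbCoeff]

/-- Complex conjugation is real-differentiable with derivative itself. [folklore] -/
theorem hasFDerivAt_conj (p : ℂ) : HasFDerivAt (fun z : ℂ ↦ conj z) conjL p :=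
  Complex.conjCLE.hasFDerivAt

/-- `N (z) = z z̄ = |z|²`. [folklore] -/
def Nf (p : ℂ) : ℂ := p * conj p

/-- `f₁ (z) = |z|² + z̄ + (i/2) |z|² z̄`. [folklore] -/
def f₁ (p : ℂ) : ℂ := Nf p + conj p + (Complex.I / 2) * (Nf p * conj p)

/-- `f₂ (z) = -z̄ - (i/2) |z|² z̄`. [folklore] -/
def f₂ (p : ℂ) : ℂ := -conj p - (Complex.I / 2) * (Nf p * conj p)

/-- `f₁ + f₂ = N`. [folklore] -/
theorem f₁_add_f₂ : f₁ + f₂ = Nf := by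
  funext p
  simp only [Pi.add_apply, f₁, f₂]
  ring

/-- The derivative of `N`: `N'(z) w = z w̄ + z̄ w`. [folklore] -/
def N' (p : ℂ) : ℂ →L[ℝ] ℂ := p • conjL + conj p • ContinuousLinearMap.id ℝ ℂ

/-- `DN = N'`. [folklore] -/
theorem hasFDerivAt_Nf (p : ℂ) : HasFDerivAt Nf (N' p) p :=
  (hasFDerivAt_id p).mul (hasFDerivAt_conj p)

/-- `N` is smooth. [folklore] -/
theorem contDiff_Nf : ContDiff ℝ ∞ Nf := contDiff_id.mul Complex.conjCLE.contDiff

/-- `f₁` is smooth. [folklore] -/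
theorem contDiff_f₁ : ContDiff ℝ ∞ f₁ :=
  (contDiff_Nf.add Complex.conjCLE.contDiff).add
    (contDiff_const.mul (contDiff_Nf.mul Complex.conjCLE.contDiff))

/-- `f₂` is smooth. [folklore] -/
theorem contDiff_f₂ : ContDiff ℝ ∞ f₂ :=
  Complex.conjCLE.contDiff.neg.sub (contDiff_const.mul (contDiff_Nf.mul Complex.conjCLE.contDiff))

/-- `Df₁ = N' + dz̄ + (i/2)(N dz̄ + z̄ N')`. [folklore] -/
theorem hasFDerivAt_f₁ (p : ℂ) :
    HasFDerivAt f₁ (N' p + conjL + (Complex.I / 2) • (Nf p • conjL + conj p • N' p)) p :=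
  ((hasFDerivAt_Nf p).add (hasFDerivAt_conj p)).add
    (((hasFDerivAt_Nf p).mul (hasFDerivAt_conj p)).const_smul (Complex.I / 2))

/-- `Df₂ = -dz̄ - (i/2)(N dz̄ + z̄ N')`. [folklore] -/
theorem hasFDerivAt_f₂ (p : ℂ) :
    HasFDerivAt f₂ (-conjL - (Complex.I / 2) • (Nf p • conjL + conj p • N' p)) p :=
  (hasFDerivAt_conj p).neg.sub
    (((hasFDerivAt_Nf p).mul (hasFDerivAt_conj p)).const_smul (Complex.I / 2))

/-- `dz̄Coeff N' = z`, i.e. `N_z̄ = z`. [folklore] -/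
@[simp] theorem dzbCoeff_N' (p : ℂ) : dzbCoeff (N' p) = p := by
  rw [N', dzbCoeff_add, dzbCoeff_smul, dzbCoeff_smul, dzbCoeff_conjL, dzbCoeff_id]
  ring

/-- `N_z̄ (z) = z`. [folklore] -/
theorem Fzb_Nf (p : ℂ) : Fzb Nf p = p := by
  rw [Fzb, (hasFDerivAt_Nf p).fderiv, dzbCoeff_N']

/-- `(f₁)_z̄ (z) = z + 1 + i |z|²`. [folklore] -/
theorem Fzb_f₁ (p : ℂ) : Fzb f₁ p = p + 1 + Complex.I * (p * conj p) := by
  rw [Fzb, (hasFDerivAt_f₁ p).fderiv, dzbCoeff_add, dzbCoeff_add, dzbCoeff_smul, dzbCoeff_add,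
    dzbCoeff_smul, dzbCoeff_smul, dzbCoeff_N', dzbCoeff_conjL, Nf]
  ring

/-- `(f₂)_z̄ (z) = -1 - i |z|²`. [folklore] -/
theorem Fzb_f₂ (p : ℂ) : Fzb f₂ p = -1 - Complex.I * (p * conj p) := by
  rw [Fzb, (hasFDerivAt_f₂ p).fderiv, dzbCoeff_sub, dzbCoeff_neg, dzbCoeff_smul, dzbCoeff_add,
    dzbCoeff_smul, dzbCoeff_smul, dzbCoeff_N', dzbCoeff_conjL, Nf]
  ring

/-- `(f₁)_z̄` is differentiable. [folklore] -/
theorem differentiable_Fzb_f₁ : Differentiable ℝ (Fzb f₁) := by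
  have h : Fzb f₁ = fun p ↦ p + 1 + Complex.I * (p * conj p) := funext Fzb_f₁
  rw [h]
  exact ((differentiable_id.add (differentiable_const _)).add
    ((differentiable_id.mul Complex.conjCLE.differentiable).const_mul _))

/-- `(f₂)_z̄` is differentiable. [folklore] -/
theorem differentiable_Fzb_f₂ : Differentiable ℝ (Fzb f₂) := by
  have h : Fzb f₂ = fun p ↦ -1 - Complex.I * (p * conj p) := funext Fzb_f₂
  rw [h]
  exact (differentiable_const _).sub
    ((differentiable_id.mul Complex.conjCLE.differentiable).const_mul _)

/-- `(f₁)_z̄ = (x + 1) + i (y + x² + y²)` vanishes nowhere (`y² + y + 1 > 0` on `x = -1`). [folklore] -/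
theorem Fzb_f₁_ne_zero (p : ℂ) : Fzb f₁ p ≠ 0 := by
  rw [Fzb_f₁, Complex.mul_conj]
  intro h
  have hre := congrArg Complex.re h
  have him := congrArg Complex.im h
  simp [Complex.normSq_apply] at hre him
  nlinarith [sq_nonneg (p.im + 1 / 2)]

/-- `(f₂)_z̄ = -1 - i |z|²` vanishes nowhere (its real part is `-1`). [folklore] -/
theorem Fzb_f₂_ne_zero (p : ℂ) : Fzb f₂ p ≠ 0 := by
  rw [Fzb_f₂, Complex.mul_conj]
  intro h
  have hre := congrArg Complex.re h
  simp at hre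

/-! ### `f₁`, `f₂` are `∂̄`-harmonic; `N = f₁ + f₂` lies in their span -/

/-- `f₁` is `∂̄`-harmonic of type `(0,0)` for the shear metric (smooth, and `Δ_∂̄ f₁ = 0` by
junk values). [folklore] -/
theorem isDolbeaultHarmonic_f₁ (h : 0 + 2 = 2) :
    IsDolbeaultHarmonic stdOrientation 0 0 h (zeroForm f₁) :=
  ⟨isSmoothForm_zeroForm contDiff_f₁, isOfType_zeroForm f₁,
    dolbeaultLaplacian_zeroForm_eq_zero h differentiable_Fzb_f₁ Fzb_f₁_ne_zero⟩

/-- `f₂` is `∂̄`-harmonic of type `(0,0)` for the shear metric (smooth, and `Δ_∂̄ f₂ = 0` by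
junk values). [folklore] -/
theorem isDolbeaultHarmonic_f₂ (h : 0 + 2 = 2) :
    IsDolbeaultHarmonic stdOrientation 0 0 h (zeroForm f₂) :=
  ⟨isSmoothForm_zeroForm contDiff_f₂, isOfType_zeroForm f₂,
    dolbeaultLaplacian_zeroForm_eq_zero h differentiable_Fzb_f₂ Fzb_f₂_ne_zero⟩

/-- `|z|² = f₁ + f₂` lies in the `ℂ`-span `dolbeaultHarmonicForms` of the `∂̄`-harmonic
`(0,0)`-forms. [folklore] -/
theorem zeroForm_Nf_mem_dolbeaultHarmonicForms (h : 0 + 2 = 2) :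
    zeroForm Nf ∈ dolbeaultHarmonicForms stdOrientation 0 0 h := by
  rw [← f₁_add_f₂, zeroForm_add]
  exact add_mem (isDolbeaultHarmonic_f₁ h).mem_dolbeaultHarmonicForms
    (isDolbeaultHarmonic_f₂ h).mem_dolbeaultHarmonicForms


/-! ### The volume form is the constant `dx ∧ dy`, hence smooth -/

/-- The Riemannian volume form of the shear metric is the standard area form (tuple form). [folklore] -/
theorem volumeForm_apply' (p : ℂ) (v : Fin 2 → T p) :
    (stdOrientation p).volumeForm v =
      Complex.re (v 0) * Complex.im (v 1) - Complex.im (v 0) * Complex.re (v 1) := by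
  have hv : v = ![v 0, v 1] := by
    funext i
    fin_cases i <;> rfl
  rw [hv, volumeForm_apply]
  rfl

/-- `dx ∧ dy` in the fixed model space: `Ω (v, w) = v₁ w₂ - v₂ w₁`. [folklore] -/
def Ωm : ℂ [⋀^Fin (1 + 1)]→L[ℝ] ℝ :=
  alternatizeUncurryFin (Complex.reCLM.smulRight (ofSubsingleton ℝ ℂ ℝ (0 : Fin 1) Complex.imCLM))

/-- `Ω (v, w) = v₁ w₂ - v₂ w₁`. [folklore] -/
theorem Ωm_apply (v : Fin 2 → ℂ) : Ωm v = (v 0).re * (v 1).im - (v 0).im * (v 1).re := by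
  simp [Ωm, alternatizeUncurryFin_apply, Fin.sum_univ_two, Fin.removeNth]
  ring

/-- `dx ∧ dy` as a `2`-form on the tangent space at `p` (the same model form at every point;
typed on `TangentSpace 𝓘(ℝ, ℂ) p` so that no comparison between the metric-normed tangent space
and the bare model fibre is ever needed). [folklore] -/
def ΩT (p : ℂ) : T p [⋀^Fin 2]→L[ℝ] ℝ := Ωm

/-- `Ω (v, w) = v₁ w₂ - v₂ w₁` (tangent-space form). [folklore] -/
theorem ΩT_apply (p : ℂ) (v : Fin 2 → T p) :
    ΩT p v = Complex.re (v 0) * Complex.im (v 1) - Complex.im (v 0) * Complex.re (v 1) :=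
  Ωm_apply v

/-- The Riemannian volume form of the shear metric is `dx ∧ dy` at every point. [folklore] -/
theorem volumeFormL_eq_ΩT (p : ℂ) : (stdOrientation p).volumeFormL = ΩT p := by
  refine ContinuousAlternatingMap.ext fun v ↦ ?_
  rw [Orientation.volumeFormL_apply, volumeForm_apply' p v, ΩT_apply]

/-- The Riemannian volume form of the shear metric is the constant form `dx ∧ dy`. [folklore] -/
theorem riemannianVolumeForm_eq : riemannianVolumeForm stdOrientation = fun p ↦ ΩT p :=
  funext fun p ↦ volumeFormL_eq_ΩT p

/-- The hypothesis `ho` of the fact holds: the Riemannian volume form of the shear metric is smooth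
(it is the constant form `dx ∧ dy`: `fun p ↦ ΩT p` is definitionally constant). [folklore] -/
theorem isSmoothForm_riemannianVolumeForm : IsSmoothForm (riemannianVolumeForm stdOrientation) := by
  intro x
  rw [inChart_eq_self, riemannianVolumeForm_eq]
  exact contDiffWithinAt_const

/-! ### `N = |z|²` is not `∂̄`-harmonic: `Δ_∂̄ N (0) = -2` -/

/-- `G_N = i z + (i/2) z λ` (`N_z̄ = z`, `τ = 2 + λ`). [folklore] -/
theorem G_Nf_eq : G Nf = fun q ↦ Complex.I * q + Complex.I / 2 * q * (lam q : ℂ) := by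
  funext q
  simp only [G, Fzb_Nf, tau]
  push_cast
  ring

/-- The correction term `(i/2) z λ` is differentiable at the origin with derivative `0`
(`λ → 0` there). [folklore] -/
theorem hasFDerivAt_mul_lam_zero :
    HasFDerivAt (fun q : ℂ ↦ Complex.I / 2 * q * (lam q : ℂ)) (0 : ℂ →L[ℝ] ℂ) 0 := by
  rw [hasFDerivAt_iff_isLittleO_nhds_zero]
  simp only [zero_add, mul_zero, zero_mul, sub_zero, _root_.zero_apply]
  refine Asymptotics.isLittleO_iff.2 (fun ε hε ↦ ?_)
  filter_upwards [tendsto_lam_zero.eventually (gt_mem_nhds hε)] with q hq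
  rw [norm_mul, norm_mul, Complex.norm_real, Real.norm_eq_abs, abs_of_nonneg (lam_nonneg q)]
  have hI : ‖Complex.I / 2‖ = 1 / 2 := by simp
  rw [hI]
  nlinarith [norm_nonneg q, lam_nonneg q]

/-- `G_N` is differentiable at the origin with derivative `w ↦ i w` (`τ(0) = 2`, `τ` continuous
at `0`). [folklore] -/
theorem hasFDerivAt_G_Nf_zero :
    HasFDerivAt (G Nf) (Complex.I • ContinuousLinearMap.id ℝ ℂ) 0 := by
  rw [G_Nf_eq]
  have h1 : HasFDerivAt (fun q : ℂ ↦ Complex.I * q) (Complex.I • ContinuousLinearMap.id ℝ ℂ) 0 :=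
    (hasFDerivAt_id (0 : ℂ)).const_mul Complex.I
  have h2 := h1.add hasFDerivAt_mul_lam_zero
  rw [add_zero] at h2
  exact h2

/-- The `2`-form `β₀ = d(G_N dz̄)(0) = i dz ∧ dz̄` in the model fibre:
`β₀ (v, w) = i (v w̄ - w v̄)`. [folklore] -/
def β₀ : ℂ [⋀^Fin (1 + 1)]→L[ℝ] ℂ :=
  alternatizeUncurryFin (cdzbL.comp (Complex.I • ContinuousLinearMap.id ℝ ℂ))

/-- `β₀ (v, w) = i v w̄ - i w v̄`. [folklore] -/
theorem β₀_apply (v : Fin (1 + 1) → ℂ) :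
    β₀ v = Complex.I * v 0 * conj (v 1) - Complex.I * v 1 * conj (v 0) := by
  simp [β₀, alternatizeUncurryFin_apply, Fin.sum_univ_two, Fin.removeNth, cdzbL]
  ring

/-- `β₀` as a `2`-form on the tangent space at the origin. [folklore] -/
def β₀T : T (0 : ℂ) [⋀^Fin (1 + 1)]→L[ℝ] ℂ := β₀

/-- `β₀ (v, w) = i v w̄ - i w v̄` (tangent-space form). [folklore] -/
theorem β₀T_apply (v : Fin (1 + 1) → T (0 : ℂ)) :
    β₀T v = (letI a : ℂ := v 0; letI b : ℂ := v 1;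
      Complex.I * a * conj b - Complex.I * b * conj a) :=
  β₀_apply v

/-- **`d (G_N dz̄)(0) = β₀`**: at the origin the junk-valued `mextDeriv` is a true derivative
(`hasFDerivAt_G_Nf_zero` and the chain rule through `b ↦ b dz̄`). [folklore] -/
theorem mextDeriv_G_Nf_zero : mextDeriv (fun p ↦ cdzb p (G Nf p)) 0 = β₀T := by
  rw [mextDeriv_eq_extDeriv]
  change alternatizeUncurryFin (fderiv ℝ (⇑cdzbL ∘ G Nf) 0) = β₀
  rw [(cdzbL.hasFDerivAt.comp 0 hasFDerivAt_G_Nf_zero).fderiv]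
  rfl

/-- `β₀` is invariant under the rotations `e^{iθ}` (it is of type `(1,1)`):
`i (e^{iθ}v)\overline{(e^{iθ}w)} = i v w̄`. [folklore] -/
theorem β₀T_comp_tangentRotate (θ : ℝ) :
    β₀T.compContinuousLinearMap (tangentRotate ℂ (0 : ℂ) θ) = β₀T := by
  ext v
  simp only [compContinuousLinearMap_apply, β₀T_apply, Function.comp_apply, tangentRotate_apply,
    smul_eq_mul, map_mul]
  have he : Complex.exp (θ * Complex.I) * conj (Complex.exp (θ * Complex.I)) = 1 := by
    rw [Complex.mul_conj, Complex.normSq_eq_norm_sq, Complex.norm_exp_ofReal_mul_I]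
    simp
  linear_combination (Complex.I * (show ℂ from v 0) * conj (show ℂ from v 1) -
    Complex.I * (show ℂ from v 1) * conj (show ℂ from v 0)) * he

/-- The `(1,1)`-component at a point of a rotation-invariant `2`-form is the form itself (the
finite Fourier average defining `typeComponent` has all its `5` terms equal). [folklore] -/
theorem typeComponent_one_one_apply_of_invariant (α : MForm 𝓘(ℝ, ℂ) ℂ ℂ (1 + 1)) (x : ℂ)
    (hα : ∀ θ : ℝ, (α x).compContinuousLinearMap (tangentRotate ℂ x θ) = α x) :
    α.typeComponent 1 1 x = α x := by
  rw [MForm.typeComponent, if_pos rfl]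
  simp only [MForm.weightComponent, hα, Nat.cast_one, sub_self, Int.cast_zero, zero_mul, neg_zero,
    Complex.ofReal_zero, Complex.exp_zero, one_smul, Finset.sum_const, Finset.card_univ,
    Fintype.card_fin]
  rw [← Nat.cast_smul_eq_nsmul ℂ, smul_smul, inv_mul_cancel₀ (Nat.cast_ne_zero.2 (by omega)),
    one_smul]

/-- `(d (G_N dz̄))^{1,1} (0) = β₀`. [folklore] -/
theorem typeComponent_mextDeriv_G_Nf_zero :
    (mextDeriv (fun p ↦ cdzb p (G Nf p))).typeComponent 1 1 0 = β₀T := by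
  rw [typeComponent_one_one_apply_of_invariant _ _ (fun θ ↦ ?_), mextDeriv_G_Nf_zero]
  rw [mextDeriv_G_Nf_zero]
  exact β₀T_comp_tangentRotate θ

/-- `Re β₀ = 2 dx ∧ dy = 2 vol`. [folklore] -/
theorem re_β₀T :
    Complex.reCLM.compContinuousAlternatingMap β₀T = (2 : ℝ) • (stdOrientation 0).volumeFormL := by
  ext v
  simp only [ContinuousLinearMap.compContinuousAlternatingMap_coe, Function.comp_apply,
    Complex.reCLM_apply, β₀T_apply, ContinuousAlternatingMap.smul_apply,
    Orientation.volumeFormL_apply, volumeForm_apply', smul_eq_mul, Complex.sub_re, Complex.mul_re,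
    Complex.mul_im, Complex.I_re, Complex.I_im, Complex.conj_re, Complex.conj_im]
  ring

/-- `Im β₀ = 0`. [folklore] -/
theorem im_β₀T : Complex.imCLM.compContinuousAlternatingMap β₀T = 0 := by
  ext v
  simp only [ContinuousLinearMap.compContinuousAlternatingMap_coe, Function.comp_apply,
    Complex.imCLM_apply, β₀T_apply, ContinuousAlternatingMap.coe_zero, Pi.zero_apply, Complex.sub_im,
    Complex.mul_re, Complex.mul_im, Complex.I_re, Complex.I_im, Complex.conj_re, Complex.conj_im]
  ring

/-- **`Δ_∂̄ |z|² (0) = -2`** for the shear metric: `(d (G_N dz̄))^{1,1}(0) = β₀ = 2 vol + i·0`,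
`⋆ vol = 1` (`hodgeStar_volumeFormL_holds`), and `Δ_∂̄ N = -⋆(…)`. [folklore] -/
theorem dolbeaultLaplacian_Nf_apply_zero (h : 0 + 2 = 2) (v : Fin 0 → T (0 : ℂ)) :
    dolbeaultLaplacian stdOrientation 0 2 h (zeroForm Nf) 0 v = -2 := by
  rw [dolbeaultLaplacian_zeroForm, Pi.neg_apply, ContinuousAlternatingMap.neg_apply,
    MForm.cHodgeStar_apply]
  simp only [Pi.add_apply, Pi.smul_apply, ContinuousAlternatingMap.add_apply,
    ContinuousAlternatingMap.smul_apply, MForm.ofReal_apply, MForm.hodgeStar_apply]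
  have hre : (MForm.typeComponent 1 1 (mextDeriv fun p ↦ cdzb p (G Nf p))).re 0 =
      (2 : ℝ) • (stdOrientation 0).volumeFormL := by
    change Complex.reCLM.compContinuousAlternatingMap
      ((MForm.typeComponent 1 1 (mextDeriv fun p ↦ cdzb p (G Nf p))) 0) = _
    rw [typeComponent_mextDeriv_G_Nf_zero, re_β₀T]
  have him : (MForm.typeComponent 1 1 (mextDeriv fun p ↦ cdzb p (G Nf p))).im 0 = 0 := by
    change Complex.imCLM.compContinuousAlternatingMap
      ((MForm.typeComponent 1 1 (mextDeriv fun p ↦ cdzb p (G Nf p))) 0) = _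
    rw [typeComponent_mextDeriv_G_Nf_zero, im_β₀T]
  have hvol := hodgeStar_volumeFormL_holds (stdOrientation 0)
  dsimp only [hodgeStar_volumeFormL] at hvol
  rw [hre, him, map_smul, _root_.map_zero, hvol]
  simp

/-- `N = |z|²` is not `∂̄`-harmonic for the shear metric. [folklore] -/
theorem not_isDolbeaultHarmonic_Nf (h : 0 + 2 = 2) :
    ¬ IsDolbeaultHarmonic stdOrientation 0 0 h (zeroForm Nf) := fun hN ↦ by
  have h1 := dolbeaultLaplacian_Nf_apply_zero h ![]
  rw [hN.2.2] at h1
  norm_num at h1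

/-! ### Conclusions -/

/-- **The shear metric violates `mem_dolbeaultHarmonicForms_iff`** (degree `0`, type `(0,0)`,
real dimension `2`): the smooth function `|z|²` lies in `dolbeaultHarmonicForms` (it is the sum of
the `∂̄`-harmonic `f₁` and `f₂`) but is not `∂̄`-harmonic. [folklore] -/
theorem not_mem_dolbeaultHarmonicForms_iff :
    ¬ mem_dolbeaultHarmonicForms_iff (E := ℂ) (M := ℂ) (k := 0) (m := 2) stdOrientation :=
  fun H ↦ not_isDolbeaultHarmonic_Nf _
    ((H isSmoothForm_riemannianVolumeForm (p := 0) (q := 0) rfl (by norm_num) _).1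
      (zeroForm_Nf_mem_dolbeaultHarmonicForms _))

end ShearMetric

attribute [local instance] Complex.finrank_real_complex_fact ShearMetric.shearBundle

/-- **`mem_dolbeaultHarmonicForms_iff` cannot be discharged as stated**: its universal closure over
Riemannian bundle metrics of no regularity is false (witness: `ShearMetric.shearBundle` on `ℂ`
with the standard orientation, `ShearMetric.not_mem_dolbeaultHarmonicForms_iff`). [folklore] -/
theorem not_forall_mem_dolbeaultHarmonicForms_iff :
    ¬ ∀ (M : Type) [TopologicalSpace M] [ChartedSpace ℂ M]
        [RiemannianBundle (fun x : M ↦ TangentSpace 𝓘(ℝ, ℂ) x)]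
        (o : (x : M) → Orientation ℝ (TangentSpace 𝓘(ℝ, ℂ) x) (Fin 2)),
        mem_dolbeaultHarmonicForms_iff (k := 0) (m := 2) o :=
  fun H ↦ ShearMetric.not_mem_dolbeaultHarmonicForms_iff (H ℂ ShearMetric.stdOrientation)

end Literature.NumberTheory.Transcendental
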